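import Summits.QuantumFields.YangMills.Theorems.BalabanUVNodesN15KingModelContinuum
import Literature.MathematicalPhysics.QuantumFieldTheory.King1986.PropagatorDerivHolderSupNorm
import Literature.MathematicalPhysics.QuantumFieldTheory.King1986.ContinuumLimitStatements

/-!
# N15 s3 KING-MODEL RUNG — KING 1986 THEOREM 3.3 (3.6)–(3.8) AT `A = 0` ON THE FULL TORUS, INHABITED BY NAME ON THE
# TYPER's SCHEMA `King1986.ContinuumLimit.Thm33Printed`, WITH KING's OWN OPERATORS, UNIFORMLY IN `K` ∕ VOLUME ∕ MASS

HONEST FRAMING (binding).  King's `A = 0` MODEL on the FULL torus `Ω = T_η` (no sub-domain, no boundary): the parallel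
transports `U(A(Γ_{y,x}))` are `1` and the printed `δ`-operators `δC^{(k)}(Ω, A) = C^{(k)}(Ω, A) − C^{(k)}(A)`,
`δG_k(Ω, A) = G_k(Ω, A) − G_k(A)` VANISH IDENTICALLY (both terms are the torus operator) — said here, typed below as literal
differences, never hidden.  What this file is: a POSITIVE CONTROL ∕ by-name inhabitant of a PRINTED hypothesis schema of
record (the `lit-balaban` typer's `ContinuumLimitStatements.lean`, §5) by GENUINE multi-level operators with ONE constant
triple for every number of levels `K ≥ 1`, every cube and every mass `0 < m² ≤ m₀²` — King p. 656: *"Theorem 3.3 is proved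
in [Ba 4]. It implies the same bounds for the vector field operators (of course with A = 0)."*  It is NOT [Ba 4]
(= [Balaban1983RegularityDecay]) at a regular `A ≠ 0`, NOT the sub-domain statement with its `∂Ω` factors, NOT Bałaban's
`G(U)`; NE2⁺ is NOT printed and not proved; node N15 is NOT discharged; counts unmoved (typed 28∕28 · discharged 5∕27); one
finite `𝕋⁴` programme at fixed `ε` elsewhere in the cell — nothing continuum ∕ `ℝ⁴` ∕ OS ∕ mass gap ∕ Clay here.
`--supports` K3⁷ helper, count-neutral.

THE DICTIONARY (schema field ↦ King object at `A = 0`, `Ω = T_η`; lattice dimension `d + 1`, block size `L` odd `≥ 3`,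
`N = L^K = η⁻¹`, unit lattice `T₁^{(k)} = Tor (fine L M_b)` = a cube of `2L^{e+1}` unit sites per direction, `η`-lattice
`T_η = Tor (fine N (fine L M_b))`):
* `distk b b′ = |b − b′|` = `tdistT (fine L M_b)` (sup-circular torus distance of unit sites);
* `distη x y = |x − y|` in unit-lattice units = `tdistT (fine N ·) x y ∕ N`;
* `dsupp f x = dist(x, supp f)` READ IN UNIT BLOCKS: the least unit-site distance from the block of `x` to a block meeting
  `supp f` (`suppDist`; `0` for `f = 0`); `dsupp2 f x y = dist({x, y}, supp f) = min`; `supNorm f = max_y |f(y)|`;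
* `transport y x = U(0) = 1`;
* `lapK = Δ^{(k)}(T, 0)` = `King1986.Torus.effLaplacian N (fine L M_b) a_K N² m²` ((2.14) p. 653, `a_K` = King's (2.13));
* `covK = C^{(k)}(T, 0)` = dag-n15-d's `kingCov L M_b a m² N K = (Δ^{(K)} + aL^{−2}Q*Q)⁻¹` ((2.15)–(2.16) p. 653, (4.32) p. 674);
* `G f = G_k(T, 0)f = A₀⁻¹f`, `A₀ = fineOp N · a_K N² m²` ((2.13) p. 653 = [Ba 4] (1.6) at `A = 0`), `DG μ f = D^η_{0,μ}G_kf =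
  N[(A₀⁻¹f)(x + e_μ) − (A₀⁻¹f)(x)]`;
* `δcovK = C^{(k)}(T,0) − C^{(k)}(0) = 0`, `δG = δDG = 0` (literal differences of the torus operator with itself); the boundary
  distances `dbdryk`, `dbdryη`, `dsuppbdry` (distances to `∂Ω = ∅`) are set to `0` — immaterial, their clauses carry the factor `0`.

WHAT IS PROVED.  §1 plumbing (`suppDist`, `supNormT`, the datum `kingThm33Data`) and its three reading lemmas;
§2 ★★ `thm33_king_zeroField_unif` — ONE `(δ₀, α, C)` (`α = 1∕2`) such that ALL NINE printed clauses of Theorem 3.3 hold for the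
datum at EVERY `K ≥ 1`, every cube `M_b = 2L^e`, every `0 < m² ≤ m₀²` (King's *"for all k ≤ K, some δ₀ > 0"*): (3.6) for `Δ^{(k)}`
from `King1986.Torus.effLaplacian_entry_le_unif` (`a_K ∈ [a_min, a]`, `aminL_le_aK`) and for `C^{(k)}` from dag-n15-d's
`kingCov_abs_le` ((4.34)); (3.7) for `G_kf` ∕ `D^η_μG_kf` from `King1986.Torus.fineOp_inv_mulVec_decay_unif` ∕
`fineOp_inv_deriv_mulVec_decay_unif` ([Ba 4] (1.10) in King's spelling, this lineage's O1 v1.2 ∕ Q1); (3.8) from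
`King1986.Torus.fineOp_inv_deriv_holder_decay_unif` ([Ba 4] (1.9), U-ii) — for ALL `x ≠ y`; the four `δ`-clauses with the
factor `0`.  §3 ★ `thm33Printed_king_zeroField : Thm33Printed (kingThm33Data …)` BY NAME, for every member.
WHAT THE CURVED CASE ADDS (one line, [Ba 4]'s content, not in the model): a REGULAR background `A ≠ 0` (Definition 3.2,
`ContinuumLimit.IsRegular35`) inside every operator, sub-domains `Ω ⊊ T_η` (unions of large blocks) with the `∂Ω` decay factors of
the `δ`-operators, and the transports `U(A(Γ_{y,x}))` in (3.8) — the dag-n15-a ∕ -c Neumann-cube and curved-gluing lanes' currency.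
LOCATORS (first-hand, PDF p0007∕p0008 of `paper:king1986-cmp102-king-u1-higgs-i`): Theorem 3.3 is stated on p. 655, displays
(3.6)–(3.8) and the `δ`-sentence on p. 656; (2.13)–(2.16) p. 653.
-/

namespace Summit.QuantumFields.YangMills.BalabanUVNodes.N15KingModelRung.Curved

open Real Finset Matrix
open Literature.MathematicalPhysics.QuantumFieldTheory.Balaban1983to89 (Params)
open Literature.MathematicalPhysics.QuantumFieldTheory.Balaban1983to89.B5Prop11Plancherel (Tor fine unitVec)
open Literature.MathematicalPhysics.QuantumFieldTheory.King1986 (aK aK_pos aK_le)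
open Literature.MathematicalPhysics.QuantumFieldTheory.King1986.Torus (fineOp effLaplacian blockOf tdistT tdistT_nonneg
  tdistT_symm effLaplacian_entry_le_unif CDelU kapU kapU_pos_le CDelU_pos aminL aminL_pos aminL_le_aK gam0L kapCT kapCT_pos_le
  fineOp_inv_mulVec_decay_unif fineOp_inv_deriv_mulVec_decay_unif fineOp_inv_deriv_holder_decay_unif)
open Literature.MathematicalPhysics.QuantumFieldTheory.King1986.ContinuumLimit (Thm33Data Thm33Printed Decay36 Decay37 Holder38)
open Summit.QuantumFields.YangMills.BalabanUVNodes.N15.KingModel (kingCov kingCov_abs_le kingRho kingRhoB kingRho_add_lt_gam0L)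

variable {d : ℕ}

/-! ## §1 The datum: King's `A = 0` operators on the full torus read through the schema's fields -/

section Plumbing

variable (N : ℕ) [NeZero N] (M : Fin (d + 1) → ℕ) [∀ μ, NeZero (M μ)]

/-- `dist(x, supp f)` READ IN UNIT BLOCKS: the least unit-lattice distance `|B(x) − B(y)|_{T₁}` over the points `y` of `supp f`
(`0` when `f = 0`).  [cite: King1986, Thm 3.3 (3.7) p.656] -/
noncomputable def suppDist (f : Tor (fine N M) → ℝ) (x : Tor (fine N M)) : ℝ := by
  classical
  exact if h : (Finset.univ.filter fun y => f y ≠ 0).Nonempty then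
    (Finset.univ.filter fun y => f y ≠ 0).inf' h (fun y => tdistT M (blockOf N M x) (blockOf N M y)) else 0

/-- The sup norm `‖f‖ = max_y |f(y)|` of a function on the (finite) `η`-lattice. [cite: King1986, Thm 3.3 (3.7) p.656] -/
noncomputable def supNormT (f : Tor (fine N M) → ℝ) : ℝ :=
  Finset.univ.sup' Finset.univ_nonempty fun y => |f y|

/-- `dist(x, supp f) ≤ |B(x) − B(y)|` for every `y ∈ supp f`. [folklore] -/
theorem suppDist_le (f : Tor (fine N M) → ℝ) (x : Tor (fine N M)) {y : Tor (fine N M)} (hy : f y ≠ 0) :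
    suppDist N M f x ≤ tdistT M (blockOf N M x) (blockOf N M y) := by
  classical
  have hmem : y ∈ Finset.univ.filter fun y => f y ≠ 0 := by simp [hy]
  have hne : (Finset.univ.filter fun y => f y ≠ 0).Nonempty := ⟨y, hmem⟩
  unfold suppDist
  rw [dif_pos hne]
  exact Finset.inf'_le _ hmem

/-- `0 ≤ dist(x, supp f)`. [folklore] -/
theorem suppDist_nonneg (f : Tor (fine N M) → ℝ) (x : Tor (fine N M)) : 0 ≤ suppDist N M f x := by
  classical
  unfold suppDist
  split_ifs with h
  · exact Finset.le_inf' _ _ fun y _ => tdistT_nonneg _ _ _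
  · exact le_rfl

/-- `|f(y)| ≤ ‖f‖`. [folklore] -/
theorem abs_le_supNormT (f : Tor (fine N M) → ℝ) (y : Tor (fine N M)) : |f y| ≤ supNormT N M f :=
  Finset.le_sup' (fun y => |f y|) (Finset.mem_univ y)

/-- `0 ≤ ‖f‖`. [folklore] -/
theorem supNormT_nonneg (f : Tor (fine N M) → ℝ) : 0 ≤ supNormT N M f := by
  obtain ⟨y⟩ := (inferInstance : Nonempty (Tor (fine N M)))
  exact (abs_nonneg _).trans (abs_le_supNormT N M f y)

end Plumbing

/-- Weakening a one-factor decay bound to smaller rate and larger constant. [folklore] -/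
private theorem decay_weaken {c C δ δ₀ D : ℝ} (hc : 0 ≤ c) (hcC : c ≤ C) (hδ : δ₀ ≤ δ) (hD : 0 ≤ D) :
    c * Real.exp (-(δ * D)) ≤ C * Real.exp (-(δ₀ * D)) := by
  have h1 : Real.exp (-(δ * D)) ≤ Real.exp (-(δ₀ * D)) :=
    Real.exp_le_exp.mpr (neg_le_neg (mul_le_mul_of_nonneg_right hδ hD))
  exact mul_le_mul hcC h1 (Real.exp_pos _).le (hc.trans hcC)

/-- The same with a non-negative third factor. [folklore] -/
private theorem decay_weaken₃ {c C δ δ₀ D F : ℝ} (hc : 0 ≤ c) (hcC : c ≤ C) (hδ : δ₀ ≤ δ) (hD : 0 ≤ D) (hF : 0 ≤ F) :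
    c * Real.exp (-(δ * D)) * F ≤ C * Real.exp (-(δ₀ * D)) * F :=
  mul_le_mul_of_nonneg_right (decay_weaken hc hcC hδ hD) hF

variable (L : ℕ) [NeZero L]

/-- **THE DATUM OF THEOREM 3.3 AT `A = 0` ON THE FULL TORUS** — King's operators of (2.13)–(2.16) with `K` levels over the unit
cube `fine L M_b` (so `T_η = Tor (fine N (fine L M_b))`, `N = L^K`), read through the schema `ContinuumLimit.Thm33Data (d + 1)`
(see the file header's dictionary): `Δ^{(k)}(T, 0) = effLaplacian`, `C^{(k)}(T, 0) = kingCov`, `G_k(T, 0) = A₀⁻¹`,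
`D^η_{0,μ}G_k = N·(forward difference of A₀⁻¹f)`, transports `1`, `δ`-operators the literal differences (`= 0`), distances to
`∂Ω = ∅` set to `0`. [cite: King1986, (2.13)–(2.16) p.653, Thm 3.3 pp.655–656] -/
noncomputable def kingThm33Data (Mb : Fin (d + 1) → ℕ) [∀ μ, NeZero (Mb μ)] (N K : ℕ) [NeZero N] (a msq : ℝ) :
    Thm33Data (d + 1) (Tor (fine L Mb)) (Tor (fine N (fine L Mb))) ℝ where
  distk := fun b b' => tdistT (fine L Mb) b b'
  distη := fun x y => tdistT (fine N (fine L Mb)) x y / N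
  dsupp := fun f x => suppDist N (fine L Mb) f x
  dsupp2 := fun f x y => min (suppDist N (fine L Mb) f x) (suppDist N (fine L Mb) f y)
  dbdryk := fun _ _ => 0
  dbdryη := fun _ _ => 0
  dsuppbdry := fun _ => 0
  supNorm := fun f => supNormT N (fine L Mb) f
  transport := fun _ _ => ContinuousLinearMap.id ℝ ℝ
  lapK := fun b b' => effLaplacian N (fine L Mb) (aK a L K) (((N : ℕ) : ℝ) ^ 2) msq b b'
  covK := fun b b' => kingCov L Mb a msq N K b b'
  δcovK := fun b b' => kingCov L Mb a msq N K b b' - kingCov L Mb a msq N K b b'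
  G := fun f => (fineOp N (fine L Mb) (aK a L K) (((N : ℕ) : ℝ) ^ 2) msq)⁻¹ *ᵥ f
  DG := fun μ f x => (N : ℝ) * (((fineOp N (fine L Mb) (aK a L K) (((N : ℕ) : ℝ) ^ 2) msq)⁻¹ *ᵥ f)
      (x + unitVec (fine N (fine L Mb)) μ) - ((fineOp N (fine L Mb) (aK a L K) (((N : ℕ) : ℝ) ^ 2) msq)⁻¹ *ᵥ f) x)
  δG := fun f x => ((fineOp N (fine L Mb) (aK a L K) (((N : ℕ) : ℝ) ^ 2) msq)⁻¹ *ᵥ f) x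
      - ((fineOp N (fine L Mb) (aK a L K) (((N : ℕ) : ℝ) ^ 2) msq)⁻¹ *ᵥ f) x
  δDG := fun μ f x =>
    (N : ℝ) * (((fineOp N (fine L Mb) (aK a L K) (((N : ℕ) : ℝ) ^ 2) msq)⁻¹ *ᵥ f) (x + unitVec (fine N (fine L Mb)) μ)
        - ((fineOp N (fine L Mb) (aK a L K) (((N : ℕ) : ℝ) ^ 2) msq)⁻¹ *ᵥ f) x)
      - (N : ℝ) * (((fineOp N (fine L Mb) (aK a L K) (((N : ℕ) : ℝ) ^ 2) msq)⁻¹ *ᵥ f) (x + unitVec (fine N (fine L Mb)) μ)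
        - ((fineOp N (fine L Mb) (aK a L K) (((N : ℕ) : ℝ) ^ 2) msq)⁻¹ *ᵥ f) x)

/-- The `δ`-operators of the datum vanish (full torus: `C^{(k)}(T, 0) − C^{(k)}(0) = 0`, `G_k(T, 0) − G_k(0) = 0`). [cite: King1986, Thm 3.3 p.656] -/
theorem kingThm33Data_delta_zero (Mb : Fin (d + 1) → ℕ) [∀ μ, NeZero (Mb μ)] (N K : ℕ) [NeZero N] (a msq : ℝ) :
    (∀ b b', (kingThm33Data L Mb N K a msq).δcovK b b' = 0) ∧
      (∀ f x, (kingThm33Data L Mb N K a msq).δG f x = 0) ∧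
      (∀ μ f x, (kingThm33Data L Mb N K a msq).δDG μ f x = 0) :=
  ⟨fun _ _ => sub_self _, fun _ _ => sub_self _, fun _ _ _ => sub_self _⟩

/-! ## §2 The nine printed clauses with ONE constant triple, uniformly in `K`, the cube and the mass -/

/-- ★★ **KING's THEOREM 3.3 AT `A = 0` ON THE FULL TORUS, ALL NINE CLAUSES, ONE `(δ₀, α, C)`**: for `L` odd `≥ 3`, `a > 0`,
`m₀² > 0` there are `δ₀ > 0`, `α = 1∕2`, `C > 0` such that for EVERY `K ≥ 1` (`N = L^K`), every cube `M_b = 2L^e` and every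
`0 < m² ≤ m₀²` the datum `kingThm33Data L M_b N K a m²` satisfies: (3.6) `|Δ^{(k)}(b, b′)|, |C^{(k)}(b, b′)| ≤ Ce^{−δ₀|b−b′|}`;
(3.7) `|G_kf(x)|, |D^η_μG_kf(x)| ≤ Ce^{−δ₀ dist(x, supp f)}‖f‖`; (3.8) `|x − y|^{−α}|D^η_μG_kf(x) − D^η_μG_kf(y)| ≤
Ce^{−δ₀ dist({x,y}, supp f)}‖f‖` for ALL `x ≠ y`; and the four `δ`-clauses (their left sides are `0`).  Sources: (3.6) —
`King1986.Torus.effLaplacian_entry_le_unif` with `a_K ∈ [a_min, a]` and dag-n15-d's `kingCov_abs_le` ((4.34)); (3.7) — [Ba 4]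
(1.10) in King's spelling (`fineOp_inv_mulVec_decay_unif`, `fineOp_inv_deriv_mulVec_decay_unif`); (3.8) — [Ba 4] (1.9)
(`fineOp_inv_deriv_holder_decay_unif`).  Model level (`A = 0`, `Ω = T_η`), count-neutral.
[cite: King1986, Thm 3.3 (3.6)–(3.8) pp.655–656, (2.13)–(2.16) p.653, (4.34) p.674; Balaban1983RegularityDecay, (1.9)–(1.10) p.573] -/
theorem thm33_king_zeroField_unif (hLodd : Odd L) (hL : 2 ≤ L) {a : ℝ} (ha : 0 < a) {m0sq : ℝ} (hm0 : 0 < m0sq) :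
    ∃ δ₀ α C : ℝ, 0 < δ₀ ∧ 0 < α ∧ α < 1 ∧ 0 < C ∧
      ∀ (K : ℕ), 1 ≤ K → ∀ (N : ℕ) [NeZero N], N = L ^ K →
      ∀ (e : ℕ) (Mb : Fin (d + 1) → ℕ) [∀ μ, NeZero (Mb μ)], (∀ μ, Mb μ = 2 * L ^ e) →
      ∀ (msq : ℝ), 0 < msq → msq ≤ m0sq →
        -- (3.6)
        Decay36 (kingThm33Data L Mb N K a msq).distk C δ₀ (kingThm33Data L Mb N K a msq).lapK ∧
        Decay36 (kingThm33Data L Mb N K a msq).distk C δ₀ (kingThm33Data L Mb N K a msq).covK ∧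
        -- (3.7)
        Decay37 (kingThm33Data L Mb N K a msq).dsupp (kingThm33Data L Mb N K a msq).supNorm C δ₀
          (kingThm33Data L Mb N K a msq).G ∧
        (∀ μ, Decay37 (kingThm33Data L Mb N K a msq).dsupp (kingThm33Data L Mb N K a msq).supNorm C δ₀
          ((kingThm33Data L Mb N K a msq).DG μ)) ∧
        -- (3.8)
        (∀ μ, Holder38 (kingThm33Data L Mb N K a msq).distη (kingThm33Data L Mb N K a msq).dsupp2
          (kingThm33Data L Mb N K a msq).supNorm (kingThm33Data L Mb N K a msq).transport α C δ₀
          ((kingThm33Data L Mb N K a msq).DG μ)) ∧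
        -- the `δ`-operators with the additional factors
        (∀ x y, |(kingThm33Data L Mb N K a msq).δcovK x y|
            ≤ C * Real.exp (-(δ₀ * (kingThm33Data L Mb N K a msq).distk x y))
              * Real.exp (-(δ₀ * (kingThm33Data L Mb N K a msq).dbdryk x y))) ∧
        (∀ f x, ‖(kingThm33Data L Mb N K a msq).δG f x‖
            ≤ C * Real.exp (-(δ₀ * (kingThm33Data L Mb N K a msq).dsupp f x)) * (kingThm33Data L Mb N K a msq).supNorm f
              * Real.exp (-(δ₀ * (kingThm33Data L Mb N K a msq).dbdryη x x)
                  - δ₀ * (kingThm33Data L Mb N K a msq).dsuppbdry f)) ∧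
        (∀ μ f x, ‖(kingThm33Data L Mb N K a msq).δDG μ f x‖
            ≤ C * Real.exp (-(δ₀ * (kingThm33Data L Mb N K a msq).dsupp f x)) * (kingThm33Data L Mb N K a msq).supNorm f
              * Real.exp (-(δ₀ * (kingThm33Data L Mb N K a msq).dbdryη x x)
                  - δ₀ * (kingThm33Data L Mb N K a msq).dsuppbdry f)) ∧
        (∀ μ f x y, x ≠ y → ((kingThm33Data L Mb N K a msq).distη x y) ^ (-α)
            * ‖(kingThm33Data L Mb N K a msq).transport y x ((kingThm33Data L Mb N K a msq).δDG μ f x)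
                - (kingThm33Data L Mb N K a msq).δDG μ f y‖
            ≤ C * Real.exp (-(δ₀ * (kingThm33Data L Mb N K a msq).dsupp2 f x y)) * (kingThm33Data L Mb N K a msq).supNorm f
              * Real.exp (-(δ₀ * (kingThm33Data L Mb N K a msq).dbdryη x y)
                  - δ₀ * (kingThm33Data L Mb N K a msq).dsuppbdry f)) := by
  have hL1 : 1 < L := by omega
  -- the five constant packs
  obtain ⟨δ₁, c₁, hδ₁, hc₁, H₁⟩ := fineOp_inv_mulVec_decay_unif (d + 1) L (by omega) ⟨hLodd, hL1⟩ ha hm0.le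
  obtain ⟨δ₂, c₂, hδ₂, hc₂, H₂⟩ := fineOp_inv_deriv_mulVec_decay_unif (d + 1) L (by omega) ⟨hLodd, hL1⟩ ha hm0.le
  obtain ⟨δ₃, c₃, hδ₃, hc₃, H₃⟩ := fineOp_inv_deriv_holder_decay_unif (d + 1) L (by omega) ⟨hLodd, hL1⟩ ha hm0.le
    (α := 1 / 2) (by norm_num) (by norm_num)
  have hamin : 0 < aminL a L := aminL_pos ha hL
  obtain ⟨hκU, -⟩ := kapU_pos_le (d := d + 1) ha hamin
  have hCU : 0 < CDelU (d + 1) a (aminL a L) := CDelU_pos ha hamin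
  obtain ⟨hκC, -⟩ := kapCT_pos_le (d := d + 1) ha hL
  have hgap : 0 < gam0L (d + 1) a L - (kingRho (d + 1) a L + kingRhoB (d + 1) a L) :=
    sub_pos.mpr (kingRho_add_lt_gam0L (dd := d + 1) ha hL)
  set cC : ℝ := (gam0L (d + 1) a L - (kingRho (d + 1) a L + kingRhoB (d + 1) a L))⁻¹ with hcC_def
  have hcC : 0 < cC := inv_pos.mpr hgap
  -- the common constants
  set δ₀ : ℝ := min (min (min δ₁ δ₂) δ₃) (min (kapU (d + 1) a (aminL a L)) (kapCT (d + 1) a L)) with hδ₀_def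
  set C : ℝ := c₁ + c₂ + c₃ + CDelU (d + 1) a (aminL a L) + cC with hC_def
  have hδ₀ : 0 < δ₀ := lt_min (lt_min (lt_min hδ₁ hδ₂) hδ₃) (lt_min hκU hκC)
  have hδ₀₁ : δ₀ ≤ δ₁ := (min_le_left _ _).trans ((min_le_left _ _).trans (min_le_left _ _))
  have hδ₀₂ : δ₀ ≤ δ₂ := (min_le_left _ _).trans ((min_le_left _ _).trans (min_le_right _ _))
  have hδ₀₃ : δ₀ ≤ δ₃ := (min_le_left _ _).trans (min_le_right _ _)
  have hδ₀U : δ₀ ≤ kapU (d + 1) a (aminL a L) := (min_le_right _ _).trans (min_le_left _ _)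
  have hδ₀C : δ₀ ≤ kapCT (d + 1) a L := (min_le_right _ _).trans (min_le_right _ _)
  have hC : 0 < C := by positivity
  have hc₁C : c₁ ≤ C := by rw [hC_def]; linarith [hc₂.le, hc₃.le, hCU.le, hcC.le]
  have hc₂C : c₂ ≤ C := by rw [hC_def]; linarith [hc₁.le, hc₃.le, hCU.le, hcC.le]
  have hc₃C : c₃ ≤ C := by rw [hC_def]; linarith [hc₁.le, hc₂.le, hCU.le, hcC.le]
  have hUC : CDelU (d + 1) a (aminL a L) ≤ C := by rw [hC_def]; linarith [hc₁.le, hc₂.le, hc₃.le, hcC.le]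
  have hcCC : cC ≤ C := by rw [hC_def]; linarith [hc₁.le, hc₂.le, hc₃.le, hCU.le]
  refine ⟨δ₀, 1 / 2, C, hδ₀, by norm_num, by norm_num, hC, ?_⟩
  intro K hK N _ hN e Mb _ hMb msq hmsq hcap
  subst hN
  -- the Bałaban parameters of this member: unit cube `2L^{e+1}` (= `fine L M_b`), `K` levels
  set P : Params := ⟨d + 1, L, e + 1, K, by omega, ⟨hLodd, hL1⟩⟩ with hP
  have hMK : ∀ μ, fine L Mb μ = P.sitesPerDir P.K := fun μ => by
    show L * Mb μ = 2 * L ^ (e + 1 + K - K)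
    rw [hMb μ, Nat.add_sub_cancel, pow_succ]; ring
  have haK := aminL_le_aK ha hL hK
  -- the reading lemmas of the datum
  have hsN : ∀ f (y : Tor (fine (L ^ K) (fine L Mb))), |f y| ≤ supNormT (L ^ K) (fine L Mb) f :=
    abs_le_supNormT (L ^ K) (fine L Mb)
  have hs0 : ∀ f : Tor (fine (L ^ K) (fine L Mb)) → ℝ, 0 ≤ supNormT (L ^ K) (fine L Mb) f :=
    supNormT_nonneg (L ^ K) (fine L Mb)
  have hD0 : ∀ f (x : Tor (fine (L ^ K) (fine L Mb))), 0 ≤ suppDist (L ^ K) (fine L Mb) f x :=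
    suppDist_nonneg (L ^ K) (fine L Mb)
  have hDle : ∀ f (x y : Tor (fine (L ^ K) (fine L Mb))), f y ≠ 0 →
      suppDist (L ^ K) (fine L Mb) f x
        ≤ tdistT (fine L Mb) (blockOf (L ^ K) (fine L Mb) x) (blockOf (L ^ K) (fine L Mb) y) :=
    fun f x y hy => suppDist_le (L ^ K) (fine L Mb) f x hy
  refine ⟨?_, ?_, ?_, ?_, ?_, ?_, ?_, ?_, ?_⟩
  · -- (3.6) for `Δ^{(k)}`
    intro b b'
    dsimp only [kingThm33Data]
    have h := effLaplacian_entry_le_unif ha hamin haK.1 haK.2 hmsq (L ^ K) (fine L Mb) b b'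
    exact h.trans (decay_weaken hCU.le hUC hδ₀U (tdistT_nonneg _ _ _))
  · -- (3.6) for `C^{(k)}`
    intro b b'
    dsimp only [kingThm33Data]
    have h := kingCov_abs_le Mb ha hmsq hL (k := K) hK b b'
    exact h.trans (decay_weaken hcC.le hcCC hδ₀C (tdistT_nonneg _ _ _))
  · -- (3.7) for `G_kf`
    intro f x
    have h := H₁ P rfl rfl hK msq hmsq.le hcap (fine L Mb) hMK (L ^ K) rfl f (supNormT (L ^ K) (fine L Mb) f)
      (suppDist (L ^ K) (fine L Mb) f x) (hsN f) x (fun y hy => hDle f x y hy)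
    dsimp only [kingThm33Data]
    rw [Real.norm_eq_abs]
    exact h.trans (decay_weaken₃ hc₁.le hc₁C hδ₀₁ (hD0 f x) (hs0 f))
  · -- (3.7) for `D^η_μG_kf`
    intro μ f x
    have h := H₂ P rfl rfl hK msq hmsq.le hcap (fine L Mb) hMK (L ^ K) rfl f (supNormT (L ^ K) (fine L Mb) f)
      (suppDist (L ^ K) (fine L Mb) f x) (hsN f) x (fun y hy => hDle f x y hy) μ
    dsimp only [kingThm33Data]
    rw [Real.norm_eq_abs]
    exact h.trans (decay_weaken₃ hc₂.le hc₂C hδ₀₂ (hD0 f x) (hs0 f))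
  · -- (3.8), all `x ≠ y`, transport `1`
    intro μ f x y hxy
    have h := H₃ P rfl rfl hK msq hmsq.le hcap (fine L Mb) hMK (L ^ K) rfl f (supNormT (L ^ K) (fine L Mb) f)
      (min (suppDist (L ^ K) (fine L Mb) f x) (suppDist (L ^ K) (fine L Mb) f y)) (hsN f) y x hxy
      (fun z hz => (min_le_right _ _).trans (hDle f y z hz)) (fun z hz => (min_le_left _ _).trans (hDle f x z hz)) μ
    dsimp only [kingThm33Data]
    rw [ContinuousLinearMap.id_apply, Real.norm_eq_abs, tdistT_symm]
    exact h.trans (decay_weaken₃ hc₃.le hc₃C hδ₀₃ (le_min (hD0 f x) (hD0 f y)) (hs0 f))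
  · -- `δC^{(k)} = 0`
    intro x y
    dsimp only [kingThm33Data]
    rw [sub_self, abs_zero]
    positivity
  · -- `δG_k = 0`
    intro f x
    dsimp only [kingThm33Data]
    rw [sub_self, norm_zero]
    exact mul_nonneg (mul_nonneg (by positivity) (hs0 f)) (Real.exp_pos _).le
  · -- `D^ηδG_k = 0`
    intro μ f x
    dsimp only [kingThm33Data]
    rw [sub_self, norm_zero]
    exact mul_nonneg (mul_nonneg (by positivity) (hs0 f)) (Real.exp_pos _).le
  · -- its Hölder quotient
    intro μ f x y _hxy
    dsimp only [kingThm33Data]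
    rw [sub_self, sub_self, map_zero, sub_zero, norm_zero, mul_zero]
    exact mul_nonneg (mul_nonneg (by positivity) (hs0 f)) (Real.exp_pos _).le

/-! ## §3 Theorem 3.3 BY NAME on the typer's schema -/

/-- ★ **`ContinuumLimit.Thm33Printed` INHABITED AT `A = 0`**: for every `K ≥ 1`, every cube `2L^e` of unit sites per block side
`L` and every `0 < m² ≤ m₀²`, King's Theorem 3.3 AS TYPED (`Thm33Printed`, the nine printed clauses behind `∃ δ₀ α C`) holds for
the datum of King's genuine `A = 0` operators on the full torus — the schema's first inhabitant; the constants do not depend on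
the member (§2).  Model level; the curved ∕ sub-domain statement is [Ba 4]'s. [cite: King1986, Thm 3.3 (3.6)–(3.8) pp.655–656] -/
theorem thm33Printed_king_zeroField (hLodd : Odd L) (hL : 2 ≤ L) {a : ℝ} (ha : 0 < a) {m0sq : ℝ} (hm0 : 0 < m0sq)
    {K : ℕ} (hK : 1 ≤ K) (N : ℕ) [NeZero N] (hN : N = L ^ K) (e : ℕ) (Mb : Fin (d + 1) → ℕ) [∀ μ, NeZero (Mb μ)]
    (hMb : ∀ μ, Mb μ = 2 * L ^ e) {msq : ℝ} (hmsq : 0 < msq) (hcap : msq ≤ m0sq) :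
    Thm33Printed (kingThm33Data L Mb N K a msq) := by
  obtain ⟨δ₀, α, C, hδ₀, hα0, hα1, -, H⟩ := thm33_king_zeroField_unif (d := d) L hLodd hL ha hm0
  exact ⟨δ₀, α, C, hδ₀, hα0, hα1, H K hK N hN e Mb hMb msq hmsq hcap⟩

/-- The family is inhabited at every size and every number of levels: for each `e, K` the cube `M_b = 2L^e` is a member
(the schema is not satisfied vacuously). [folklore] -/
theorem thm33Printed_king_zeroField_cube (hLodd : Odd L) (hL : 2 ≤ L) {a : ℝ} (ha : 0 < a) {m0sq : ℝ} (hm0 : 0 < m0sq)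
    {K : ℕ} (hK : 1 ≤ K) (e : ℕ) {msq : ℝ} (hmsq : 0 < msq) (hcap : msq ≤ m0sq) :
    Thm33Printed (kingThm33Data (d := d) L (fun _ => 2 * L ^ e) (L ^ K) K a msq) :=
  thm33Printed_king_zeroField L hLodd hL ha hm0 hK (L ^ K) rfl e _ (fun _ => rfl) hmsq hcap

end Summit.QuantumFields.YangMills.BalabanUVNodes.N15KingModelRung.Curved
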